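import Mathlib

/-!
# DeflatedSchurOperator — the algebra of Galerkin (two-level) deflation of a Schur operator
(hubbard-algo crew (5), D-0042 R2(e); companion of `SchurPairExpansion.lean` and of the p1 g7 kit studies
j263631 / j264315 (pair-expansion preconditioner family, letter (B)) and j266705 (frozen-deflation / subspace
letter (C′)), `HOME/hubbard-algo-p1/kit/runs/`; pure matrix algebra over `ℝ` — NO number and NO bound on any
Hubbard quantity lives here)

HONEST FRAMING: first certified bounds; not a superconductivity verdict.  This file books the exact identities
behind the instrument both studies use: given a symmetric Schur matrix `M`, a coarse space spanned by the columns
of `W`, and an inverse `Einv` of the Galerkin matrix `E = Wᵀ M W`, the DEFLATED operator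
`N = M - M W Einv Wᵀ M` (what deflated / two-level PCG iterates on) satisfies

* `deflated_mul_coarse` : `N * W = 0` — the coarse space is in the kernel of `N`;
* `deflated_mulVec_of_conjugate` : `Wᵀ M v = 0 → N v = M v` — on the `M`-conjugate complement of the coarse
  space `N` acts as `M` itself (so deflating EXACT pencil eigenvectors leaves the other eigenpairs untouched: the
  "two-sided deflation oracle" of the studies);
* `deflated_eq_proj_mul` / `proj_mul_proj` : `N = P * M` with the deflation projector `P = 1 - M W Einv Wᵀ`,
  and `P * P = P`;
* `deflated_transpose` : `N` is symmetric when `M` and `Einv` are;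
* `deflated_eq_sub_gram` : `N = M - K Einv Kᵀ` with `K = M W` — `N` is `M` minus a Gram-type term of rank at
  most the coarse dimension, which is the shape Weyl's inequality is applied to in the studies' rank lower bound
  (`κ_deflated ≥ θ_{n-R} / θ_{R+1}` for every `R`-dimensional coarse space; the inequality itself is not
  formalised here).
-/

namespace Summit.Ventures.CertifiedManyBodySolver.HubbardAlg.DeflatedSchurOperator

open Matrix

variable {n r : Type*} [Fintype n] [Fintype r] [DecidableEq n] [DecidableEq r]

/-- The Galerkin (coarse) matrix `E = Wᵀ M W`. -/
def galerkin (M : Matrix n n ℝ) (W : Matrix n r ℝ) : Matrix r r ℝ := Wᵀ * M * W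

/-- The deflation projector `P = 1 - M W Einv Wᵀ`. -/
def proj (M : Matrix n n ℝ) (W : Matrix n r ℝ) (Einv : Matrix r r ℝ) : Matrix n n ℝ :=
  1 - M * W * Einv * Wᵀ

/-- The deflated operator `N = M - M W Einv Wᵀ M`. -/
def deflated (M : Matrix n n ℝ) (W : Matrix n r ℝ) (Einv : Matrix r r ℝ) : Matrix n n ℝ :=
  M - M * W * Einv * Wᵀ * M

omit [DecidableEq r] in
/-- `N = P * M`. -/
theorem deflated_eq_proj_mul (M : Matrix n n ℝ) (W : Matrix n r ℝ) (Einv : Matrix r r ℝ) :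
    deflated M W Einv = proj M W Einv * M := by
  unfold deflated proj
  rw [Matrix.sub_mul, Matrix.one_mul]

omit [DecidableEq n] [DecidableEq r] in
/-- `N = M - K Einv Kᵀ` with `K = M W`, when `M` is symmetric. -/
theorem deflated_eq_sub_gram (M : Matrix n n ℝ) (W : Matrix n r ℝ) (Einv : Matrix r r ℝ) (hM : Mᵀ = M) :
    deflated M W Einv = M - (M * W) * Einv * (M * W)ᵀ := by
  unfold deflated
  rw [Matrix.transpose_mul, hM, Matrix.mul_assoc (M * W * Einv) Wᵀ M]

omit [DecidableEq n] in
/-- The coarse space lies in the kernel of the deflated operator: `N * W = 0`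
(hypothesis: `Einv` is a right inverse of the Galerkin matrix, `E * Einv = 1`). -/
theorem deflated_mul_coarse (M : Matrix n n ℝ) (W : Matrix n r ℝ) (Einv : Matrix r r ℝ)
    (hE : galerkin M W * Einv = 1) : deflated M W Einv * W = 0 := by
  have hE' : Einv * galerkin M W = 1 := mul_eq_one_comm.mp hE
  unfold galerkin at hE'
  unfold deflated
  rw [Matrix.sub_mul]
  have : M * W * Einv * Wᵀ * M * W = M * W * (Einv * (Wᵀ * M * W)) := by
    simp only [Matrix.mul_assoc]
  rw [this, hE', Matrix.mul_one, sub_self]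

omit [DecidableEq n] [DecidableEq r] in
/-- On the `M`-conjugate complement of the coarse space the deflated operator IS `M`:
`Wᵀ M v = 0 → N v = M v`. -/
theorem deflated_mulVec_of_conjugate (M : Matrix n n ℝ) (W : Matrix n r ℝ) (Einv : Matrix r r ℝ)
    (v : n → ℝ) (hv : (Wᵀ * M) *ᵥ v = 0) : deflated M W Einv *ᵥ v = M *ᵥ v := by
  unfold deflated
  rw [Matrix.sub_mulVec]
  have : (M * W * Einv * Wᵀ * M) *ᵥ v = (M * W * Einv) *ᵥ ((Wᵀ * M) *ᵥ v) := by
    rw [Matrix.mulVec_mulVec]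
    congr 1
    simp only [Matrix.mul_assoc]
  rw [this, hv, Matrix.mulVec_zero, sub_zero]

/-- `P` kills the `M`-image of the coarse space: `P * (M * W) = 0`. -/
theorem proj_mul_image (M : Matrix n n ℝ) (W : Matrix n r ℝ) (Einv : Matrix r r ℝ)
    (hE : galerkin M W * Einv = 1) : proj M W Einv * (M * W) = 0 := by
  have hE' : Einv * galerkin M W = 1 := mul_eq_one_comm.mp hE
  unfold galerkin at hE'
  unfold proj
  rw [Matrix.sub_mul, Matrix.one_mul]
  have : M * W * Einv * Wᵀ * (M * W) = M * W * (Einv * (Wᵀ * M * W)) := by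
    simp only [Matrix.mul_assoc]
  rw [this, hE', Matrix.mul_one, sub_self]

/-- The deflation projector is idempotent: `P * P = P` (given `E * Einv = 1`). -/
theorem proj_mul_proj (M : Matrix n n ℝ) (W : Matrix n r ℝ) (Einv : Matrix r r ℝ)
    (hE : galerkin M W * Einv = 1) : proj M W Einv * proj M W Einv = proj M W Einv := by
  have h0 : proj M W Einv * (M * W * Einv * Wᵀ) = 0 := by
    rw [Matrix.mul_assoc (M * W) Einv Wᵀ, ← Matrix.mul_assoc (proj M W Einv) (M * W) (Einv * Wᵀ),
      proj_mul_image M W Einv hE, Matrix.zero_mul]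
  conv_lhs => rw [show proj M W Einv * proj M W Einv = proj M W Einv * 1 - proj M W Einv * (M * W * Einv * Wᵀ)
    from by unfold proj; rw [← Matrix.mul_sub]]
  rw [h0, Matrix.mul_one, sub_zero]

omit [DecidableEq n] [DecidableEq r] in
/-- The deflated operator is symmetric when `M` and `Einv` are. -/
theorem deflated_transpose (M : Matrix n n ℝ) (W : Matrix n r ℝ) (Einv : Matrix r r ℝ)
    (hM : Mᵀ = M) (hEinv : Einvᵀ = Einv) : (deflated M W Einv)ᵀ = deflated M W Einv := by
  unfold deflated
  rw [Matrix.transpose_sub, hM]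
  congr 1
  simp only [Matrix.transpose_mul, Matrix.transpose_transpose, hM, hEinv, Matrix.mul_assoc]

omit [DecidableEq r] in
/-- `N = M * Pᵀ` as well (symmetric form), when `M` and `Einv` are symmetric. -/
theorem deflated_eq_mul_proj_transpose (M : Matrix n n ℝ) (W : Matrix n r ℝ) (Einv : Matrix r r ℝ)
    (hM : Mᵀ = M) (hEinv : Einvᵀ = Einv) : deflated M W Einv = M * (proj M W Einv)ᵀ := by
  have h1 := deflated_transpose M W Einv hM hEinv
  rw [← h1, deflated_eq_proj_mul, Matrix.transpose_mul, hM]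

omit [DecidableEq n] [DecidableEq r] in
/-- The Gram-type correction `K Einv Kᵀ` is positive semidefinite when `Einv` is — so `N = M - G` with
`G ⪰ 0` of rank at most the coarse dimension (the shape used with Weyl's inequality in the rank lower bound). -/
theorem gram_correction_posSemidef (M : Matrix n n ℝ) (W : Matrix n r ℝ) (Einv : Matrix r r ℝ)
    (hEinv : Einv.PosSemidef) : ((M * W) * Einv * (M * W)ᵀ).PosSemidef := by
  have h := hEinv.mul_mul_conjTranspose_same (M * W)
  simpa [Matrix.conjTranspose_eq_transpose_of_trivial] using h

omit [DecidableEq n] [DecidableEq r] in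
/-- Hence the deflated operator is dominated by `M` in the Loewner order: `M - N ⪰ 0`. -/
theorem sub_deflated_posSemidef (M : Matrix n n ℝ) (W : Matrix n r ℝ) (Einv : Matrix r r ℝ)
    (hM : Mᵀ = M) (hEinv : Einv.PosSemidef) : (M - deflated M W Einv).PosSemidef := by
  rw [deflated_eq_sub_gram M W Einv hM, sub_sub_cancel]
  exact gram_correction_posSemidef M W Einv hEinv

end Summit.Ventures.CertifiedManyBodySolver.HubbardAlg.DeflatedSchurOperator
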